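import Summits.QuantumFields.YangMills.Theorems.BalabanUVNodesN19RateEdgeHolderD4AtRunsAlong
import Summits.QuantumFields.YangMills.Theorems.BalabanUVNodesN19RatesAtTuningWindow

/-!
# BalabanUVNodes ∕ N19 — K3⁷'s N19′ SLOT UNDER THE `ForSmallCouplings` PREFIX AT THE TUNING WINDOW: the link reading at the runs of record (this seat's `…D4AtRunsAlong`)
# with NODE O's window-quantified clauses ((T)'s `DecayBound` ∕ pair discs ∕ the selector) asked ONLY on `Window γ ⊆ R.u3.W` (γ the tuning radius), J's tuple letter
# `θ.γ² ≤ e⁻¹` GONE (a threshold `γ ≤ e^{−1∕2}` of the prefix), and (v′-17)'s smallness window + the sign `0 < ρ` taken OUT of the reading (letters of `𝔯.lit.u3`: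
# hypotheses of the edge, discharged under the prefix from UNIFORM letters by an explicit threshold)

Cell `pub-ymgap`, HUMAN RULING D-0062 (Track A) + D-0149 (work-bound push, director-ym №197), WIDTH SEAT `pub-ymgap-dag-n19-w3` (N19 NE7, seat 3 of 3), generation g2;
bus INTENT-10 (merged with the announced INTENT-12 — one file).  Cluster item K3⁷ «SpineGivenEndpointR13SepCoPH» (stmt-QuantumFields-20544), plan's skeleton v2 145a664ea9c38a7b ∕ v3
02f6f498332fdbee (N19′'s slot `KeyedCoreEdgeHolderD4 β cr (rrOfRecord 𝔯 ksel)`, rates predicate `PHolderD4 β`); filed `--kind proof --supports` that item `--as helper` (it proves no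
registered stub).  COUNT-NEUTRAL.  THEOREMS ONLY; 0 `def`; 0 `sorry`; `N`-generic, guard-generic `G`, reading-generic `cr`; NO Theses import.  Imports this seat's `…D4AtRunsAlong`
(p598960; brings E′ p597989, AtRuns §1 p593217, INTENT-5 p596921, the composer p595910) and `…N19RatesAtTuningWindow` (p600935: `ratesHolderAt_shrink_window`, `readOutAt_shrink_window`)
— CITED BY NAME, none edited.

THE POINT (numbers, not adjectives).  (1) Every N19′ link reading so far quantifies NODE O's window clauses over the RECORD's window `R.u3.W = Window θ.γ` and therefore carries
J's tuple letter `θ.γ² ≤ e⁻¹` ((T)'s window smallness needs it; admissibility gives `θ.γ < 1` only — NOTHING in the tree supplies it).  Under the prefix the runs of a bare sequence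
tuned within `]0, γ]` live in the γ-box and K4's rates DESCEND to the SHRUNK carriers `⟨R.u3.C, Window γ, γ, R.u3.κ, …⟩` (p600935), so E′ is run AT THE SHRUNK BUNDLE: the reading
asks (T)'s `DecayBound R.u3.EA (Window γ) E₀T R.u3.κ`, the pair discs `∀ s ∈ Window γ`, the selector `∀ s ∈ Window γ, 0 < bsel s ≤ γ` (each WEAKER), and the window smallness
becomes `γ² ≤ e⁻¹` — a THRESHOLD (`γ ≤ e^{−1∕2}`), discharged in §2.  (2) The (v′-17) block of `…D4AtRunsAlong` still displays `R.u3.cr·R.u3.C₉·R.u3.ω·(γ³ + 2γ∕b) ≤ (1 − R.u3.ρ)∕2`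
(node U2's fixed-point smallness at the tuning radius) and `0 < R.u3.ρ` — conditions on node U3's RESIDUAL letters (`(𝔯.lit F θ hP g₀ os).u3.{cr, C₉, ω, ρ}`, K-uniform per
construction), not on NODE O's ledger; here they are HYPOTHESES OF THE EDGE THEOREM (§1 `hρ0`, `hsmall`), removed from `hlink`, and §2 discharges them from UNIFORM LETTERS at the
tuple `∀ g₀ os k, 0 < ρ ∧ ρ ≤ ρ₁ ∧ cr·C₉·ω ≤ M` (`ρ₁ < 1`, `0 ≤ M`; a displayed HYPOTHESIS on `𝔯` — Bałaban's (1.20)–(1.22) constants are uniform in the small bare coupling, the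
tree's `𝔯` is residual) by the threshold `γs := min 1 ((1 − ρ₁) ∕ (2·M·(1 + 2∕b) + 2))` (kernel-checked real arithmetic).  What the reading keeps of (v′-17): `R.u3.ρ ≤ θc` (NODE O's
ledger rate dominates node U3's).  Versus v9 at any reading: 8 (J) + 7 (AtRuns) + 2 (Along) + 3 (here) = 20 conjuncts out of the reading, three window clauses weakened to `Window γ`.

WHAT THIS FILE PROVES (`R := rateCarriersOfRecord₁₃CoPH 𝔯 F θ hP g₀ os k`, `D := datumOfRecord₁₃CoPH F N θ hP`, `S := cr F θ hP g₀ os`).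
* §1 ★★ `h19HolderD4_datumOfRecord₁₃CoPH_of_linkReadingAtTuningWindow_tuned` — on TUNED bare sequences (`D.Tuned γ gIR g₀`, `γ ≤ θ.γ`, `γ² ≤ e⁻¹`) with `b ≤ β ≤ b′` along the
  runs of record (`0 < b`), GIVEN `0 < R.u3.ρ` and the smallness window at `γ`: `PHolderD4 β D R → ∃ δ, NE7.Core S … δ ∧ Summable δ` MODULO `hlink`; proof = E′ at the same-tuple
  pair predicate whose rate component IS the shrunk bundle (structure literal; p600935's descent), E′'s clause reassembled as in `…D4AtRunsAlong` at `γ′ := γ`.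
* §2 ★★ `forSmallCouplings_h19HolderD4_datumOfRecord₁₃CoPH_of_linkReadingAtTuningWindow` — UNDER THE CRUX's PREFIX BY NAME from K1⁷'s `BetaBoundsInInterval D.C.toB12 γ₀ b b′`, `0 < b`
  (`DagBinding.WorldP.b_pos`) AND uniform U3 letters, threshold `min (min γ₀ (min θ.γ e^{−1∕2})) γs` (the slot text at a selector `ks` is its `.mono`, used in §3).
* §3 ★★ `hybridNE7Under_datumOfRecord₁₃CoPH_of_linkReadingAtTuningWindow` — THE PLUG at any reading `cr` (composer §2 `keyedGuarded₁₃CoPH_of_keyedFacesP_fsc_forallRates`): h20∕h21 at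
  `cr`, ∀-`g₀` `PHolderD4` rates, `hx` at `cr`, K1⁷'s window with `0 < b` (`hβw`) and uniform letters (`hunif`) at every guarded admissible tuple, `hlink` ⇒ `HybridNE7Under
  (datumOfRecord₁₃CoPH F N θ hP) (EndpointExistence …)`; at `N = 2`, `G :=` the item guard = K3⁷'s conclusion as leaf D states it, MODULO `hlink`, the other slots, the two clauses.

HONEST FRAMING.  Count-neutral kernel bookkeeping + two explicit thresholds; `hlink` is a HYPOTHESIS (NODE O's world at the runs of record on the tuning window; 0 instances in the
tree); `D.Tuned` (K2⁷), `BetaBoundsInInterval` + `0 < b` (K1⁷, `WorldP.b_pos`; lower half UNPRINTED T09.F, upper half [Balaban1987RG1] (1.22) p. 264 proof deferred) and the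
UNIFORM-LETTERS clause on `𝔯` are HYPOTHESES; `cr 𝔯 G ks` PARAMETERS.  NOT a proof of `stub_expansion13H` or of K3⁷; no skeleton text touched.  NE7 NOT PRINTED ∕ NOT proved; nothing of
Bałaban's asserted or instantiated (K0⁷ OPEN); N19 NOT discharged; K3⁷ NOT claimed; counts unmoved (typed 28∕28 · discharged 5∕27 · A 5∕28).  One finite four-torus at fixed ε — R4
closes the CONDITIONAL finite-𝕋⁴ rung `BalabanLadder.UV` only; NOT infinite volume ∕ OS ∕ mass gap; the YM mass gap (Clay) is NOT proved by any of this.  Standard axioms.  Edits nothing.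
-/

set_option autoImplicit false

noncomputable section

open Finset MeasureTheory
open scoped BigOperators Matrix Matrix.Norms.L2Operator

namespace Summit.QuantumFields.YangMills.BalabanUVNodes.N19RateEdgeHolderD4AtTuningWindow

open Literature.MathematicalPhysics.QuantumFieldTheory.Balaban1983to89
open T4OutputRate T4RecentScale T4GoodClassBudget T4CauchySum T4TowerRateComposition T4TowerRateDischarge
open T4EtaRateMin (Readings NE3Shape)
open T4RateLiaison (GaugeDominated)
open T4CouplingMatching (EventualLowerH)
open FlowStep (RGEqH prefixOf)
open TreeLengthTorus (TFaceConnected torusTreeLen)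
open B12TreeDecay (kappa₀)
open Summit.QuantumFields.BalabanUV.T4Continuum
open AveragingDeficitDualResidual (dualC1 dualC2)
open AveragingDeficitDerivWallProof (wallConst)
open AveragingDeficitPeriodicCounting (IsPeriodicDir)
open MinimalActionSandwich (IsMinimiser minAct)
open MinimalActionRate (sfClass)
open MinimalActionRefine (RegularSup gradConst)
open NE3EnergyShapes (IsUnitarySite IsPeriodicSite)
open NE3.LeafIndexSockets (LeafH3sup)
open Summit.QuantumFields.BalabanUV.T4Continuum.Spine
open Summit.QuantumFields.BalabanUV.T4Continuum.Spine.NE4 (runFlow box_and_pin_of_tuned)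
open Summit.QuantumFields.BalabanUV.T4Continuum.NE1p.DressedRoot (DressedTower DressedStabilityStrict)
open Summit.QuantumFields.YangMills.BalabanUVNodes.N19LedgerLinkSync (LedgerDataSync LedgerAtSync)
open YMDAG.UVSplit (SpineCarriers SpineRecordPred InputsPred U3Carriers RateCarriers RateRecordPred N14At N18At N22At ReadOutAt)
open Summit.QuantumFields.YangMills.BalabanUVNodes.N16HolderDefs (CovRootHolder N16HolderAt)
open Summit.QuantumFields.YangMills.BalabanUVNodes.SpineRatesHolder (RatesHolderAt)
open Literature.MathematicalPhysics.QuantumFieldTheory.Balaban1983to89.T4Continuum (T4Family ULoop)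
open T4WeightBudget (RelWeightBound)
open T4IndicatorShell (ShellWeightBound)
open T4ContinuumYM4Torus (ForSmallCouplings)
open T4ApexHybrid (HybridNE7Under)
open YMDAG.UVSplit (Datum RateReading₁₃CoPH rateCarriersOfRecord₁₃CoPH)
open YMDAG.UVSplit (SpineReading₁₃CoPH ShellSplit₁₃CoPH)
open Node00 (Stage13HParams datumOfRecord₁₃CoPH SiteSeqKey)
open Summit.QuantumFields.YangMills.BalabanUVNodes.N19RateEdgeHolderAlong (rateEdge_of_linkReadingAlong_byName_pairDiscC1Holder)
open Summit.QuantumFields.YangMills.BalabanUVNodes.N19RateEdgeHolderD4AtRuns (runClauses_of_pinnedRuns_tuned invSq_of_pinnedRuns_along)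
open Summit.QuantumFields.YangMills.BalabanUVNodes.N19InEdgesAlongRuns (alongLower_runFlow_of_tuned alongLower_of_pinnedRuns)
open Summit.QuantumFields.YangMills.BalabanUVNodes.N19CoreEdgeFSCComposer (keyedGuarded₁₃CoPH_of_keyedFacesP_fsc_forallRates)
open Summit.QuantumFields.YangMills.BalabanUVNodes.N19RatesAtTuningWindow (ratesHolderAt_shrink_window readOutAt_shrink_window)
open Summit.QuantumFields.YangMills.BalabanUVNodes.N19RateEdgeRecordRunLetters
  (rgEqH_congr two_le_ne3_L_rateCarriersOfRecord₁₃CoPH signs_of_readOutAt window_sq_le_exp_neg_one)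
open Summit.QuantumFields.YangMills.BalabanUVNodes.N19RateEdgeRecordRunLettersTuned
  (invSq_le_of_rgEqH_along rgEqH_runFlow_datumOfRecord₁₃CoPH_of_tuned betaAlong_runFlow_le_of_betaBoundsInInterval)

/-! ## §1 The link reading AT THE TUNING WINDOW on tuned bare sequences ⇒ N19′'s edge GIVEN `PHolderD4 β`, `0 < ρ` and the smallness window -/

section AtTuningWindow

variable {N : ℕ} [NeZero N]
  (cr : (F : T4Family) → (θ : Stage13HParams F N) → θ.Provisos₁₃CoPH F N → (ℕ → ℝ) → List (ULoop F) → SpineCarriers)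
  (𝔯 : RateReading₁₃CoPH N) (G : ∀ {F : T4Family}, Stage13HParams F N → Prop) {β : ℝ} (hβ1 : β ≤ 1)
  (hlink : ∀ (F : T4Family) (θ : Stage13HParams F N) (hP : θ.Provisos₁₃CoPH F N), G θ → θ.Admissible F N →
    ∀ (γ gIR b : ℝ) (g₀ : ℕ → ℝ), (datumOfRecord₁₃CoPH F N θ hP).Tuned γ gIR g₀ → γ ≤ θ.γ → γ ^ 2 ≤ Real.exp (-1) → 0 < b →
    (∀ K m, 0 ≤ m → m < K → b ≤ (datumOfRecord₁₃CoPH F N θ hP).βfun m (prefixOf (runFlow (datumOfRecord₁₃CoPH F N θ hP) g₀ K) m)) →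
    ∀ (os : List (ULoop F)) (k : ℕ),
      let S : SpineCarriers := cr F θ hP g₀ os
      let R : RateCarriers N := rateCarriersOfRecord₁₃CoPH 𝔯 F θ hP g₀ os k
      let D : Datum F N := datumOfRecord₁₃CoPH F N θ hP
      letI := S.dec
      ∃ (_ : DecidableEq R.u3.C.Dom) (F' : Type) (ι' X' : Type) (_ : MeasurableSpace ι')
        (L : LedgerDataSync R.u3.C F' ι' S.ι) (Rd : Readings ι' X') (bsel : (ℕ → ℝ) → ℝ) (EB : Functional R.u3.C R.u3.C.BgB)
        (θc θ₃ : ℝ) (g : ℕ → ℕ → ℝ)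
        (uA : ℕ → ι' → R.u3.C.BgA) (uB : ℕ → ι' → R.u3.C.BgB)
        (Pf : ℕ → Params) (d₀ L₀ Koff : ℕ) (cells : (K j : ℕ) → R.u3.C.Dom → Finset (Site (Pf K) j))
        (H033 : Flow → ℕ → Prop) (I : Type) (fam : I → B14.Sect2Data) (Lb βw : ℝ) (κ₁ : ℕ) (Gv Cl : ℝ) (K₁ : ℕ)
        (Λ₀ N₀ : ℝ) (dressed : R.u3.C.Dom → Prop) (_ : DecidablePred dressed)
        (c' t ε₁ θ γ₃ l₁ : ℝ)
        (sel : ℕ → (B7Prop1Explicit.Site 4 → Fin 4 → (Matrix (Fin N) (Fin N) ℂ)ˣ) → (B7Prop1Explicit.Site 4 → Fin 4 → (Matrix (Fin N) (Fin N) ℂ)ˣ))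
        (rd : ι' → (B7Prop1Explicit.Site 4 → Fin 4 → (Matrix (Fin N) (Fin N) ℂ)ˣ)) (k₀ : ℕ)
        (E₀T κ₁T C₁T : ℝ) (q₁ : ℕ),
        (∀ K i, i ≤ K → g K i = runFlow D g₀ K i) ∧ (∀ K i, K < i → g K i = gIR) ∧
        EB = (fun s => R.u3.EB (bsel s) s) ∧
        (∀ (Sz : ℕ → ℝ → S.ι → ℕ → ℝ) (E₀ : ℝ) (m : ℕ) (a : ℝ) (Cw Λg : ℝ),
          (∀ K t, |t| ≤ S.l₀ → ∀ τ ∈ S.T K \ S.Bad K t, ∀ v ∈ Rd.dom, ∀ j ≤ K,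
            |∑ X ∈ L.fac K t τ with R.u3.C.scale X = j,
                (Real.log (Real.exp (EB (fun i => g (K + 1) (i + 1)) (uB K v) X
                    - EB (fun i => g (K + 1) (i + 1)) L.oneB X))
                  - Real.log (Real.exp (R.u3.EA (g K) (uA K v) X - R.u3.EA (g K) L.oneA X)))| ≤ Sz K t τ j) →
          0 ≤ E₀ → 0 < a → a < 1 →
          (∀ K t, |t| ≤ S.l₀ → ∀ τ ∈ S.T K \ S.Bad K t, ∀ j ≤ K,
            Sz K t τ j ≤ S.vol * (E₀ * ((K : ℝ) + 1) ^ m * a ^ (K - j))) →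
          (∀ K, Multiplicity (L.All K) R.u3.C.scale (fun X => Real.exp (-(R.u3.κ * R.u3.C.d X))) Cw S.vol Λg K) →
          (∀ K t, |t| ≤ S.l₀ → ∀ τ ∈ S.T K \ S.Bad K t,
            WindowMultiplicity (L.facO K t τ) L.scO L.wO Cw S.vol Λg (jlogOf L.Cl K) K) →
          1 ≤ Λg → L.θ' ≤ Λg →
          LedgerAtSync { L with S := Sz, E₀ := E₀, m := m, a := a, Cw := Cw, Λg := Λg } S.l₀ S.vol S.T S.Bad
            (fun K t τ => S.A K t τ - S.shA K t τ) (fun K t τ => S.B K t τ - S.shB K t τ) Rd R.u3.EA EB R.u3.κ g uA uB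
            R.u3.ω θc R.u3.θ θ₃) ∧
        0 ≤ S.vol ∧
        (∀ K t, |t| ≤ S.l₀ → ∀ τ ∈ S.T K \ S.Bad K t,
          WindowMultiplicity (L.facO K t τ) L.scO L.wO L.Cw S.vol L.Λg (jlogOf L.Cl K) K) ∧
        0 ≤ L.Cw ∧ 1 ≤ L.Λg ∧ L.θ' ≤ L.Λg ∧
        (∀ K, (Pf K).d = d₀) ∧ (∀ K, (Pf K).L = L₀) ∧ (∀ K, (Pf K).K = Koff + K) ∧
        (∀ K, (Fintype.card (Site (Pf K) (Pf K).K) : ℝ) = S.vol) ∧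
        kappa₀ (4 * 2 ^ d₀) (2 * d₀) ≤ R.u3.κ ∧
        (∀ K, ∀ X ∈ L.All K,
          (cells K (R.u3.C.scale X + Koff) X).Nonempty ∧ TFaceConnected (cells K (R.u3.C.scale X + Koff) X)) ∧
        (∀ K j, Set.InjOn (cells K j) ↑((L.All K).filter fun X => R.u3.C.scale X + Koff = j)) ∧
        (∀ K, ∀ X ∈ L.All K, torusTreeLen (cells K (R.u3.C.scale X + Koff) X) ≤ R.u3.C.d X) ∧
        B14.Thm2Printed H033 fam Lb βw κ₁ ∧ βw < 1 ∧ 0 < βw ∧ 1 < Lb ∧ 1 ≤ Gv ∧ 0 ≤ Cl ∧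
        (∀ p K, (R.ne1.𝒯.B p K).PositionalCount fun j k => N₀ * Λ₀ ^ (k - j)) ∧ 0 ≤ N₀ ∧ 0 ≤ Λ₀ ∧ Λ₀ ≤ R.ne1.Λ ∧
        (∀ K t, |t| ≤ S.l₀ → ∀ τ ∈ S.T K \ S.Bad K t, ∀ v ∈ Rd.dom, ∀ j ≤ K, ∃ (i : I) (w : (fam i).Ω) (j' : ℕ),
          (fam i).flow.SatisfiesRG (fam i).K ∧ H033 (fam i).flow (fam i).K ∧ 1 ≤ j' ∧ j' ≤ (fam i).K ∧
          (fam i).K - j' = K - j ∧ (fam i).K ≤ K + K₁ ∧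
          (∀ n, 0 ≤ (fam i).gammaVol n w) ∧ (fam i).gammaVol (fam i).K w ≤ S.vol ∧
          (∀ n, n < (fam i).K → n < jlogOf Cl (fam i).K → (fam i).gammaVol n w = 0) ∧
          (∀ n, n < (fam i).K → jlogOf Cl (fam i).K ≤ n → (fam i).gammaVol n w ≤ S.vol * Gv ^ ((fam i).K - n)) ∧
          |∑ X ∈ (L.fac K t τ).filter (fun X => ¬ dressed X) with R.u3.C.scale X = j,
              (R.u3.EA (g K) (uA K v) X - R.u3.EA (g K) L.oneA X)| ≤ |(fam i).eTerm j' (fam i).K w|) ∧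
        (∀ K t, |t| ≤ S.l₀ → ∀ τ ∈ S.T K \ S.Bad K t, ∀ v ∈ Rd.dom, ∀ j ≤ K, ∃ (i : I) (w : (fam i).Ω) (j' : ℕ),
          (fam i).flow.SatisfiesRG (fam i).K ∧ H033 (fam i).flow (fam i).K ∧ 1 ≤ j' ∧ j' ≤ (fam i).K ∧
          (fam i).K - j' = K - j ∧ (fam i).K ≤ K + K₁ ∧
          (∀ n, 0 ≤ (fam i).gammaVol n w) ∧ (fam i).gammaVol (fam i).K w ≤ S.vol ∧
          (∀ n, n < (fam i).K → n < jlogOf Cl (fam i).K → (fam i).gammaVol n w = 0) ∧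
          (∀ n, n < (fam i).K → jlogOf Cl (fam i).K ≤ n → (fam i).gammaVol n w ≤ S.vol * Gv ^ ((fam i).K - n)) ∧
          |∑ X ∈ (L.fac K t τ).filter (fun X => ¬ dressed X) with R.u3.C.scale X = j,
              (EB (fun i => g (K + 1) (i + 1)) (uB K v) X - EB (fun i => g (K + 1) (i + 1)) L.oneB X)|
            ≤ |(fam i).eTerm j' (fam i).K w|) ∧
        (∀ K t, |t| ≤ S.l₀ → ∀ τ ∈ S.T K \ S.Bad K t, ∀ v ∈ Rd.dom,
          ∃ (pA : R.ne1.P) (βA : R.u3.C.Dom → (R.ne1.𝒯.B pA K).Birth) (Q : Finset (R.ne1.𝒯.B pA K).Cube) (pB : R.ne1.P)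
            (KB : ℕ) (βB : R.u3.C.Dom → (R.ne1.𝒯.B pB KB).Birth),
          (∀ X ∈ (L.fac K t τ).filter (fun X => dressed X), (R.ne1.𝒯.B pA K).birthScale (βA X) = R.u3.C.scale X) ∧
          (∀ j, Set.InjOn βA ↑(((L.fac K t τ).filter (fun X => dressed X)).filter fun X => R.u3.C.scale X = j)) ∧
          (∀ c ∈ Q, (R.ne1.𝒯.B pA K).cubeScale c = K) ∧ ((Q.card : ℝ) ≤ S.vol) ∧
          (∀ X ∈ (L.fac K t τ).filter (fun X => dressed X), ∃ c ∈ Q, βA X ∈ (R.ne1.𝒯.B pA K).feltAt c) ∧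
          (∀ X ∈ (L.fac K t τ).filter (fun X => dressed X), KB - (R.ne1.𝒯.B pB KB).birthScale (βB X) = K - R.u3.C.scale X) ∧
          (∀ X ∈ (L.fac K t τ).filter (fun X => dressed X),
            |R.u3.EA (g K) (uA K v) X - R.u3.EA (g K) L.oneA X| ≤ (R.ne1.𝒯.B pA K).size (βA X) K) ∧
          (∀ X ∈ (L.fac K t τ).filter (fun X => dressed X),
            |EB (fun i => g (K + 1) (i + 1)) (uB K v) X - EB (fun i => g (K + 1) (i + 1)) L.oneB X|
              ≤ (R.ne1.𝒯.B pB KB).size (βB X) KB)) ∧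
        R.ne3.g = gradConst 4 c' ∧ 1 ≤ R.ne3.Nper ∧ 0 ≤ R.ne3.b ∧ 0 ≤ c' ∧ R.ne3.b ≤ t ∧ c' ≤ t ∧ 0 ≤ R.ne3.C ∧
        (2 : ℝ) ^ 91 * (R.ne3.L : ℝ) ^ 17 * t ≤ 1 ∧ (2 : ℝ) ^ 76 * (R.ne3.L : ℝ) ^ 12 * t ≤ R.ne3.ε ∧
        16 * B7Prop2Explicit.C0 4 * R.ne3.ε ≤ 3 ∧ 1024 * (4 + 1) * (4 + 4) * (R.ne3.L : ℝ) ^ 2 * R.ne3.ε ≤ 1 ∧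
        ε₁ ≤ 1 / 4 ∧ ε₁ ≤ R.ne3.b ∧ 4 * ε₁ ≤ c' ∧ R.ne3.dom ⊆ sfClass 4 R.ne3.L R.ne3.Nper ε₁ 0 ∧
        LeafH3sup 4 R.ne3.L R.ne3.Nper R.ne3.ε R.ne3.b c' R.ne3.dom ∧
        (∀ V ∈ R.ne3.dom, ∀ k : ℕ, IsMinimiser 4 (sfClass 4 R.ne3.L R.ne3.Nper R.ne3.ε) R.ne3.L R.ne3.Nper k V (sel k V)) ∧
        (∀ V ∈ R.ne3.dom, ∀ k : ℕ, RegularSup 4 R.ne3.L R.ne3.Nper R.ne3.b c' k (sel k V)) ∧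
        0 < θ ∧ θ ^ 6 = ((R.ne3.L : ℝ))⁻¹ ∧ 0 < R.ne3.Λ₂' ∧ 0 < γ₃ ∧
        R.ne3.C * (wallConst 4 R.ne3.L * (R.ne3.Nper : ℝ) ^ 2 *
          (Real.sqrt (gradConst 4 c') * dualC2 4 R.ne3.L + 2 * R.ne3.b ^ 2 * dualC1 4 R.ne3.L)) ≤ γ₃ ^ 3 ∧
        0 < l₁ ∧ R.ne3.Λ₁ ≤ l₁ ^ 3 ∧ γ₃ * θ ^ 2 ≤ l₁ * R.ne3.Nper ∧ θ ^ ((3 : ℝ) * β - 2) ≤ θ₃ ∧ θ₃ < 1 ∧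
        (∀ v ∈ Rd.dom, rd v ∈ R.ne3.dom) ∧
        (∀ k, ∀ v ∈ Rd.dom, Rd.act k v = minAct 4 (sfClass 4 R.ne3.L R.ne3.Nper R.ne3.ε) R.ne3.L R.ne3.Nper k (rd v)) ∧
        (R.ne3.Nper : ℝ) ^ 4 ≤ Rd.vol ∧ 1 ≤ k₀ ∧
        (∀ K : ℕ, ∀ v ∈ Rd.dom, ∀ (u : B7Prop1Explicit.Site 4 → (Matrix (Fin N) (Fin N) ℂ)ˣ)
          (Z : B7Prop1Explicit.Site 4 → Fin 4 → Matrix (Fin N) (Fin N) ℂ) (M : ℝ),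
          IsUnitarySite u → IsPeriodicSite u ((R.ne3.Nper * R.ne3.L ^ (k₀ + K) : ℕ) : ℤ) → T4AveragingDeficitWall.IsSkewDir Z →
          IsPeriodicDir Z ((R.ne3.Nper * R.ne3.L ^ (k₀ + K) : ℕ) : ℤ) →
          B7Prop1Explicit.gaugeAct u (sel (k₀ + K) (rd v)) =
            T4AveragingDeficitWall.vary (B7Prop2Explicit.rescale R.ne3.L (B7Prop1Explicit.bavg R.ne3.L (sel (k₀ + K + 1) (rd v)))) Z 1 →
          (∀ (x : B7Prop1Explicit.Site 4) (κ : Fin 4), (R.ne3.L : ℝ) ^ (k₀ + K) * ‖Z x κ‖ ≤ M) →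
          (∀ (x : B7Prop1Explicit.Site 4) (μ κ : Fin 4), ((R.ne3.L : ℝ) ^ (k₀ + K)) ^ 2 *
              ‖T4AveragingDeficitWall.Ad (B7Prop2Explicit.rescale R.ne3.L (B7Prop1Explicit.bavg R.ne3.L (sel (k₀ + K + 1) (rd v)))
                  (x + B7Prop1Explicit.e κ) μ) (Z (x + B7Prop1Explicit.e μ) κ) - Z x κ‖ ≤ M) →
          R.u3.C.gauge (uA K v) (R.u3.C.transport (uB K v)) ≤ M) ∧
        R.u3.ρ ≤ θc ∧
        DecayBound R.u3.EA (Window γ) E₀T R.u3.κ ∧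
        (∀ s ∈ Window γ, ∀ (X : R.u3.C.Dom) (U U' : R.u3.C.BgA),
          R.u3.C.gauge U U' < κ₁T * B14.alphaJ C₁T q₁ (s (R.u3.C.scale X)) →
          ∃ f : ℂ → ℂ, DifferentiableOn ℂ f (Metric.ball (0 : ℂ) (κ₁T * B14.alphaJ C₁T q₁ (s (R.u3.C.scale X)))) ∧
            f 0 = (R.u3.EA s U X : ℂ) ∧ f (R.u3.C.gauge U U' : ℂ) = (R.u3.EA s U' X : ℂ) ∧
            ∀ z ∈ Metric.ball (0 : ℂ) (κ₁T * B14.alphaJ C₁T q₁ (s (R.u3.C.scale X))),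
              ‖f z‖ ≤ E₀T * Real.exp (-(R.u3.κ * R.u3.C.d X))) ∧
        0 ≤ E₀T ∧ 0 < κ₁T ∧ 0 < C₁T ∧
        (∀ s ∈ Window γ, 0 < bsel s ∧ bsel s ≤ γ))

include hβ1 hlink

/-- ★★ **N19′'s EDGE ON TUNED BARE SEQUENCES, MODULO THE LINK READING AT THE TUNING WINDOW, U3's SMALLNESS∕SIGN AS HYPOTHESES** [bookkeeping]: at every guarded
admissible Stage-13 tuple, every bare sequence `g₀` TUNED to `gIR` within `]0, γ]`, `γ ≤ θ.γ` ([Balaban1987RG1] Thm 2 p. 259's renormalisation condition at the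
datum of record — a HYPOTHESIS), `γ² ≤ e⁻¹`, with `b ≤ β ≤ b′` ALONG ITS RUNS OF RECORD, `0 < b` (K1⁷'s window; a HYPOTHESIS), every `os`, run length `k`, GIVEN `0 < R.u3.ρ` and
node U2's smallness window at the tuning radius (`hsmall`):
`RatesHolderAt D R β ∧ ReadOutAt D R.u3 ∧ (0 ≤ R.u3.ρ ∧ R.u3.ρ < 1) → ∃ δ, NE7.Core (cr …) … δ ∧ Summable δ` for `R := rateCarriersOfRecord₁₃CoPH 𝔯 F θ hP g₀ os k`,
`D := datumOfRecord₁₃CoPH F N θ hP`.  Proof: E′ at the same-tuple pair predicate whose RATE COMPONENT IS THE SHRUNK BUNDLE `⟨R.ne1, R.ne2, R.ne3, ⟨R.u3.C, Window γ, γ, R.u3.κ, …⟩⟩`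
(structure literal; `RatesHolderAt` ∕ `ReadOutAt` descend by `ratesHolderAt_shrink_window` ∕ `readOutAt_shrink_window`, `R.u3.W = Window θ.γ` being `rfl`); E′'s clause REASSEMBLED
from `hlink`, J's named facts, AtRuns §1 at `γ′ := γ`, INTENT-5's transport and `window_sq_le_exp_neg_one hγe` (`bβ := b`, `k₀β := 0`, `γt := γ`, `β′_T := max b′ 0`).  NOT NE7;
N19 NOT discharged; `hlink` (NODE O's world at the runs of record on the tuning window + the remaining in-edge letters) DISPLAYED. -/
theorem h19HolderD4_datumOfRecord₁₃CoPH_of_linkReadingAtTuningWindow_tuned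
    (F : T4Family) (θ : Stage13HParams F N) (hP : θ.Provisos₁₃CoPH F N) (hG : G θ) (hθ : θ.Admissible F N) {γ gIR b' : ℝ} {g₀ : ℕ → ℝ}
    (ht : (datumOfRecord₁₃CoPH F N θ hP).Tuned γ gIR g₀) (hγle : γ ≤ θ.γ) (hγe : γ ^ 2 ≤ Real.exp (-1)) {b : ℝ} (hb0 : 0 < b)
    (hlow : ∀ K m, 0 ≤ m → m < K →
      b ≤ (datumOfRecord₁₃CoPH F N θ hP).βfun m (prefixOf (runFlow (datumOfRecord₁₃CoPH F N θ hP) g₀ K) m))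
    (halong : ∀ K i, i < K →
      (datumOfRecord₁₃CoPH F N θ hP).βfun i (prefixOf (runFlow (datumOfRecord₁₃CoPH F N θ hP) g₀ K) i) ≤ b')
    (os : List (ULoop F)) (k : ℕ) (hρ0 : 0 < (rateCarriersOfRecord₁₃CoPH 𝔯 F θ hP g₀ os k).u3.ρ)
    (hsmall : (rateCarriersOfRecord₁₃CoPH 𝔯 F θ hP g₀ os k).u3.cr * (rateCarriersOfRecord₁₃CoPH 𝔯 F θ hP g₀ os k).u3.C₉ *
        (rateCarriersOfRecord₁₃CoPH 𝔯 F θ hP g₀ os k).u3.ω * (γ ^ 3 + 2 * γ / b) ≤ (1 - (rateCarriersOfRecord₁₃CoPH 𝔯 F θ hP g₀ os k).u3.ρ) / 2)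
    (hP4 : RatesHolderAt (datumOfRecord₁₃CoPH F N θ hP) (rateCarriersOfRecord₁₃CoPH 𝔯 F θ hP g₀ os k) β ∧
      ReadOutAt (datumOfRecord₁₃CoPH F N θ hP) (rateCarriersOfRecord₁₃CoPH 𝔯 F θ hP g₀ os k).u3 ∧
      (0 ≤ (rateCarriersOfRecord₁₃CoPH 𝔯 F θ hP g₀ os k).u3.ρ ∧ (rateCarriersOfRecord₁₃CoPH 𝔯 F θ hP g₀ os k).u3.ρ < 1)) :
    letI := (cr F θ hP g₀ os).dec
    ∃ δ : ℕ → ℝ, NE7.Core (cr F θ hP g₀ os).l₀ (cr F θ hP g₀ os).vol (cr F θ hP g₀ os).T (cr F θ hP g₀ os).Bad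
      (fun K t τ => (cr F θ hP g₀ os).A K t τ - (cr F θ hP g₀ os).shA K t τ) (fun K t τ => (cr F θ hP g₀ os).B K t τ - (cr F θ hP g₀ os).shB K t τ) δ ∧
      Summable δ :=
  rateEdge_of_linkReadingAlong_byName_pairDiscC1Holder
    (fun F D g₀ os S R' => ∃ (θ : Stage13HParams F N) (hP : θ.Provisos₁₃CoPH F N) (k : ℕ) (γ gIR b b' : ℝ), G θ ∧ θ.Admissible F N ∧
      D = datumOfRecord₁₃CoPH F N θ hP ∧ S = cr F θ hP g₀ os ∧
      R' = ⟨(rateCarriersOfRecord₁₃CoPH 𝔯 F θ hP g₀ os k).ne1, (rateCarriersOfRecord₁₃CoPH 𝔯 F θ hP g₀ os k).ne2, (rateCarriersOfRecord₁₃CoPH 𝔯 F θ hP g₀ os k).ne3,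
        ⟨(rateCarriersOfRecord₁₃CoPH 𝔯 F θ hP g₀ os k).u3.C, Window γ, γ, (rateCarriersOfRecord₁₃CoPH 𝔯 F θ hP g₀ os k).u3.κ,
          (rateCarriersOfRecord₁₃CoPH 𝔯 F θ hP g₀ os k).u3.EA, (rateCarriersOfRecord₁₃CoPH 𝔯 F θ hP g₀ os k).u3.EB, (rateCarriersOfRecord₁₃CoPH 𝔯 F θ hP g₀ os k).u3.θ,
          (rateCarriersOfRecord₁₃CoPH 𝔯 F θ hP g₀ os k).u3.C₅, (rateCarriersOfRecord₁₃CoPH 𝔯 F θ hP g₀ os k).u3.Λ, (rateCarriersOfRecord₁₃CoPH 𝔯 F θ hP g₀ os k).u3.C₉,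
          (rateCarriersOfRecord₁₃CoPH 𝔯 F θ hP g₀ os k).u3.ω, (rateCarriersOfRecord₁₃CoPH 𝔯 F θ hP g₀ os k).u3.cr, (rateCarriersOfRecord₁₃CoPH 𝔯 F θ hP g₀ os k).u3.ρ⟩⟩ ∧
      ReadOutAt D (rateCarriersOfRecord₁₃CoPH 𝔯 F θ hP g₀ os k).u3 ∧ (rateCarriersOfRecord₁₃CoPH 𝔯 F θ hP g₀ os k).u3.ρ < 1 ∧
      (datumOfRecord₁₃CoPH F N θ hP).Tuned γ gIR g₀ ∧ γ ≤ θ.γ ∧ γ ^ 2 ≤ Real.exp (-1) ∧ 0 < b ∧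
      (∀ K m, 0 ≤ m → m < K → b ≤ (datumOfRecord₁₃CoPH F N θ hP).βfun m (prefixOf (runFlow (datumOfRecord₁₃CoPH F N θ hP) g₀ K) m)) ∧
      (∀ K i, i < K → (datumOfRecord₁₃CoPH F N θ hP).βfun i (prefixOf (runFlow (datumOfRecord₁₃CoPH F N θ hP) g₀ K) i) ≤ b') ∧
      0 < (rateCarriersOfRecord₁₃CoPH 𝔯 F θ hP g₀ os k).u3.ρ ∧
      (rateCarriersOfRecord₁₃CoPH 𝔯 F θ hP g₀ os k).u3.cr * (rateCarriersOfRecord₁₃CoPH 𝔯 F θ hP g₀ os k).u3.C₉ *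
        (rateCarriersOfRecord₁₃CoPH 𝔯 F θ hP g₀ os k).u3.ω * (γ ^ 3 + 2 * γ / b) ≤ (1 - (rateCarriersOfRecord₁₃CoPH 𝔯 F θ hP g₀ os k).u3.ρ) / 2)
    hβ1 (by
      rintro F D g₀ os S R' ⟨θ, hP, k, γ, gIR, b, b', hG, hθ, rfl, rfl, rfl, hD4, hρ1, ht, hγle, hγe, hb0, hlow, halong, hρ0, hsmallb⟩
      obtain ⟨iDom, F', ι', X', iMeas, L, Rd, bsel, EB, θc, θ₃, g, uA, uB, hrest⟩ := hlink F θ hP hG hθ γ gIR b g₀ ht hγle hγe hb0 hlow os k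
      obtain ⟨Pf, d₀, L₀, Koff, cells, H033, I, fam, Lb, βw, κ₁, Gv, Cl, K₁, Λ₀, N₀, dressed, iDr, hrest⟩ := hrest
      obtain ⟨c', t, ε₁, ϑ, γ₃, l₁, sel, rd, k₀, E₀T, κ₁T, C₁T, q₁, hrest⟩ := hrest
      obtain ⟨hgle, hggt, hEB, hL, hvol, homult, hCw, hΛg, hθΛ, hPd, hPL, hPK, hcard, hκ₀, hdom, hinj, hlen, hrest⟩ := hrest
      obtain ⟨h11, hβw1, hβw0, hLb, hGv, hCl, hcount, hN₀, hΛ₀, hle, hidA, hidB, hidD, hrest⟩ := hrest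
      obtain ⟨hg3, hNper, hb, hc', hbt, hct, hC3, hsmall3, hεt, hε1, hε2, hε₁, hε₁b, hε₁c, hdom3, hH3, hsel, hreg, hrest⟩ := hrest
      obtain ⟨hθ0, hθ6, hΛ₂', hγ₃, hγ3, hl₁, hΛl₁, hfit, hθ₃θ, hθ₃1, hrd, hact, hvol3, hk₀, hdomC1, hrest⟩ := hrest
      obtain ⟨hρθc, hdecT, hdiscT, hE₀T, hκ₁T, hC₁T, hbsel⟩ := hrest
      have hsg := signs_of_readOutAt hD4
      have hrg := rgEqH_runFlow_datumOfRecord₁₃CoPH_of_tuned θ hP ht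
      obtain ⟨hrun, hpin, hboxt, hgA, hgB, hIR0, hIRγ⟩ := runClauses_of_pinnedRuns_tuned (datumOfRecord₁₃CoPH F N θ hP) hrg ht le_rfl hgle hggt
      have hup := invSq_of_pinnedRuns_along (datumOfRecord₁₃CoPH F N θ hP) hrg halong ht hgle
      have hlo := alongLower_of_pinnedRuns (datumOfRecord₁₃CoPH F N θ hP) hgle hlow
      have hsmallβ : (rateCarriersOfRecord₁₃CoPH 𝔯 F θ hP g₀ os k).u3.cr * (rateCarriersOfRecord₁₃CoPH 𝔯 F θ hP g₀ os k).u3.C₉ *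
          (rateCarriersOfRecord₁₃CoPH 𝔯 F θ hP g₀ os k).u3.ω * ((((0 : ℕ) : ℝ) + 1) * γ ^ 3 + 2 * γ / b) ≤
            (1 - (rateCarriersOfRecord₁₃CoPH 𝔯 F θ hP g₀ os k).u3.ρ) / 2 := by
        simpa only [Nat.cast_zero, zero_add, one_mul] using hsmallb
      refine ⟨iDom, F', ι', X', iMeas, L, Rd, bsel, EB, θc, θ₃, g, uA, uB, Pf, d₀, L₀, Koff, cells, H033, I, fam, Lb, βw, κ₁, Gv, Cl, K₁, Λ₀, N₀,
        dressed, iDr, c', t, ε₁, ϑ, γ₃, l₁, sel, rd, k₀, gIR, b, γ, 0, E₀T, κ₁T, C₁T, max b' 0, q₁, hEB, hL, hvol, homult, hCw, hΛg, hθΛ, hPd, hPL,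
        hPK, hcard, hκ₀, hdom, hinj, hlen, h11, hβw1, hβw0, hLb, hGv, hCl, hcount, hN₀, hΛ₀, hle, hidA, hidB, hidD, ?_⟩
      exact ⟨hg3, two_le_ne3_L_rateCarriersOfRecord₁₃CoPH 𝔯 θ hP g₀ os k, hNper, hb, hc', hbt, hct, hC3, hsmall3, hεt, hε1, hε2, hε₁, hε₁b, hε₁c,
        hdom3, hH3, hsel, hreg, hθ0, hθ6, hΛ₂', hγ₃, hγ3, hl₁, hΛl₁, hfit, hθ₃θ, hθ₃1, hrd, hact, hvol3, hk₀, hdomC1,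
        hsg.1.1, hsg.1.2.1, hsg.1.2.2, hrun, hpin, readOutAt_shrink_window _ _ hγle rfl hD4, hb0, hlo, lt_of_lt_of_le hIR0 hIRγ, le_rfl, hsmallβ, hρ0, hρ1,
        lt_of_lt_of_le hIR0 hIRγ, hρθc, hboxt,
        hdecT, hdiscT, hE₀T, hκ₁T, hC₁T, window_sq_le_exp_neg_one hγe, hup, le_max_right _ _, hgA, hgB, hbsel⟩)
    F _ g₀ os _ _ ⟨θ, hP, k, γ, gIR, b, b', hG, hθ, rfl, rfl, rfl, hP4.2.1, hP4.2.2.2, ht, hγle, hγe, hb0, hlow, halong, hρ0, hsmall⟩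
    (ratesHolderAt_shrink_window _ _ β hγle rfl hP4.1)

/-! ## §2 UNDER THE CRUX's PREFIX BY NAME: K1⁷'s window (both halves), the window-smallness threshold, AND the U2 smallness threshold from uniform letters -/

/-- ★★ **N19′'s SLOT UNDER THE `ForSmallCouplings` PREFIX AT THE TUNING WINDOW, UNIFORM U3 LETTERS** [bookkeeping]: at every guarded admissible Stage-13 tuple carrying K1⁷'s
window `BetaBoundsInInterval D.C.toB12 γ₀ b b′` with `0 < b` AND uniform letters `∀ g₀ os k, 0 < ρ ∧ ρ ≤ ρ₁ ∧ cr·C₉·ω ≤ M` (`ρ₁ < 1`, `0 ≤ M`; HYPOTHESES): FOR ALL SMALL COUPLINGS —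
threshold `min (min γ₀ (min θ.γ e^{−1∕2})) γs`, `γs := min 1 ((1−ρ₁)∕(2M(1+2∕b)+2))` discharging node U2's smallness window — every `os k`: `PHolderD4 β D R → ∃ δ, NE7.Core (cr …) … δ ∧ Summable δ`.
This is the `g₀`-clause of J's slot theorem restricted to the prefix the K3⁷ item's conclusion `HybridNE7Under` and its extraction slot live under; (B) and
`EndpointExistence` are not used.  NOT NE7; N19 NOT discharged; NOT a proof of `stub_expansion13H` (whose N19′ slot quantifies over every `g₀`). -/
theorem forSmallCouplings_h19HolderD4_datumOfRecord₁₃CoPH_of_linkReadingAtTuningWindow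
    (F : T4Family) (θ : Stage13HParams F N) (hP : θ.Provisos₁₃CoPH F N) (hG : G θ) (hθ : θ.Admissible F N) {γ₀ b b' : ℝ} (hγ₀ : 0 < γ₀) (hb0 : 0 < b)
    (hβ : DagBinding.BetaBoundsInInterval (datumOfRecord₁₃CoPH F N θ hP).C.toB12 γ₀ b b') {M ρ₁ : ℝ} (hM : 0 ≤ M) (hρ₁ : ρ₁ < 1)
    (hunif : ∀ (g₀ : ℕ → ℝ) (os : List (ULoop F)) (k : ℕ), 0 < (rateCarriersOfRecord₁₃CoPH 𝔯 F θ hP g₀ os k).u3.ρ ∧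
      (rateCarriersOfRecord₁₃CoPH 𝔯 F θ hP g₀ os k).u3.ρ ≤ ρ₁ ∧
      (rateCarriersOfRecord₁₃CoPH 𝔯 F θ hP g₀ os k).u3.cr * (rateCarriersOfRecord₁₃CoPH 𝔯 F θ hP g₀ os k).u3.C₉ * (rateCarriersOfRecord₁₃CoPH 𝔯 F θ hP g₀ os k).u3.ω ≤ M) :
    ForSmallCouplings (datumOfRecord₁₃CoPH F N θ hP) fun g₀ => ∀ (os : List (ULoop F)) (k : ℕ),
      (RatesHolderAt (datumOfRecord₁₃CoPH F N θ hP) (rateCarriersOfRecord₁₃CoPH 𝔯 F θ hP g₀ os k) β ∧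
        ReadOutAt (datumOfRecord₁₃CoPH F N θ hP) (rateCarriersOfRecord₁₃CoPH 𝔯 F θ hP g₀ os k).u3 ∧
        (0 ≤ (rateCarriersOfRecord₁₃CoPH 𝔯 F θ hP g₀ os k).u3.ρ ∧ (rateCarriersOfRecord₁₃CoPH 𝔯 F θ hP g₀ os k).u3.ρ < 1)) →
      letI := (cr F θ hP g₀ os).dec
      ∃ δ : ℕ → ℝ, NE7.Core (cr F θ hP g₀ os).l₀ (cr F θ hP g₀ os).vol (cr F θ hP g₀ os).T (cr F θ hP g₀ os).Bad
        (fun K t τ => (cr F θ hP g₀ os).A K t τ - (cr F θ hP g₀ os).shA K t τ) (fun K t τ => (cr F θ hP g₀ os).B K t τ - (cr F θ hP g₀ os).shB K t τ) δ ∧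
        Summable δ := by
  set A : ℝ := M * (1 + 2 / b) with hA
  have hA0 : 0 ≤ A := mul_nonneg hM (by positivity)
  set γs : ℝ := min 1 ((1 - ρ₁) / (2 * A + 2)) with hγs
  have hγs0 : 0 < γs := lt_min one_pos (div_pos (by linarith) (by linarith))
  refine ⟨min (min γ₀ (min θ.γ (Real.exp (-1 / 2)))) γs, lt_min (lt_min hγ₀ (lt_min hθ.toStage9.gamma_pos (Real.exp_pos _))) hγs0,
    fun γ hγ hγle => ⟨1, one_pos, fun gIR _ _ g₀ ht os k hP4 => ?_⟩⟩
  have hγle' : γ ≤ min γ₀ (min θ.γ (Real.exp (-1 / 2))) := hγle.trans (min_le_left _ _)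
  have hγe : γ ^ 2 ≤ Real.exp (-1) := by
    have h := pow_le_pow_left₀ hγ.le (hγle'.trans ((min_le_right _ _).trans (min_le_right _ _))) 2
    have he : Real.exp (-1 / 2) ^ 2 = Real.exp (-1) := by rw [← Real.exp_nat_mul]; norm_num
    rwa [he] at h
  obtain ⟨hρ0, hρρ₁, hM'⟩ := hunif g₀ os k
  have hγ1 : γ ≤ 1 := (hγle.trans (min_le_right _ _)).trans (min_le_left _ _)
  have hγA : γ ≤ (1 - ρ₁) / (2 * A + 2) := (hγle.trans (min_le_right _ _)).trans (min_le_right _ _)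
  have hfac0 : 0 ≤ γ ^ 3 + 2 * γ / b := by positivity
  have hfac : γ ^ 3 + 2 * γ / b ≤ γ * (1 + 2 / b) := by
    have h3 : γ ^ 3 ≤ γ := by simpa using pow_le_pow_of_le_one hγ.le hγ1 (show 1 ≤ 3 by norm_num)
    have : γ * (1 + 2 / b) = γ + 2 * γ / b := by ring
    linarith
  have hAγ : A * γ ≤ (1 - ρ₁) / 2 := by
    refine (mul_le_mul_of_nonneg_left hγA hA0).trans ?_
    rw [mul_div_assoc', div_le_div_iff₀ (by linarith) (by norm_num)]
    nlinarith
  have hsmall : (rateCarriersOfRecord₁₃CoPH 𝔯 F θ hP g₀ os k).u3.cr * (rateCarriersOfRecord₁₃CoPH 𝔯 F θ hP g₀ os k).u3.C₉ *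
      (rateCarriersOfRecord₁₃CoPH 𝔯 F θ hP g₀ os k).u3.ω * (γ ^ 3 + 2 * γ / b) ≤ (1 - (rateCarriersOfRecord₁₃CoPH 𝔯 F θ hP g₀ os k).u3.ρ) / 2 := by
    calc (rateCarriersOfRecord₁₃CoPH 𝔯 F θ hP g₀ os k).u3.cr * (rateCarriersOfRecord₁₃CoPH 𝔯 F θ hP g₀ os k).u3.C₉ *
          (rateCarriersOfRecord₁₃CoPH 𝔯 F θ hP g₀ os k).u3.ω * (γ ^ 3 + 2 * γ / b)
        ≤ M * (γ ^ 3 + 2 * γ / b) := mul_le_mul_of_nonneg_right hM' hfac0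
      _ ≤ M * (γ * (1 + 2 / b)) := mul_le_mul_of_nonneg_left hfac hM
      _ = A * γ := by rw [hA]; ring
      _ ≤ (1 - ρ₁) / 2 := hAγ
      _ ≤ (1 - (rateCarriersOfRecord₁₃CoPH 𝔯 F θ hP g₀ os k).u3.ρ) / 2 := by linarith
  exact h19HolderD4_datumOfRecord₁₃CoPH_of_linkReadingAtTuningWindow_tuned cr 𝔯 G hβ1 hlink F θ hP hG hθ ht
    (hγle'.trans ((min_le_right _ _).trans (min_le_left _ _))) hγe hb0
    (alongLower_runFlow_of_tuned _ hβ (hγle'.trans (min_le_left _ _)) ht)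
    (fun K i hi => betaAlong_runFlow_le_of_betaBoundsInInterval _ hβ (hγle'.trans (min_le_left _ _)) (ht K).1 i hi) os k hρ0 hsmall hP4

/-! ## §3 THE PLUG (any reading `cr`): K3⁷'s conclusion from v2∕v3's other faces, THIS reading under the prefix, K1⁷'s window, uniform letters -/
/-- ★★ **THE PLUG AT ANY READING `cr`, ON THE TUNING WINDOW, β-WINDOW FROM K1⁷, UNIFORM U3 LETTERS** [bookkeeping]: from N20 ∕ N21 at `cr` (leaf D's `h20`∕`h21` shapes), v2∕v3's ∀-`g₀` rates `PHolderD4 β` (spelled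
out) at `rr := rateCarriersOfRecord₁₃CoPH 𝔯 … (ks …)`, leaf D's extraction clause `hx` at `cr`, K1⁷'s interval-form window with `0 < b` at every guarded admissible tuple
(`hβw`; `DagBinding.WorldP.b_pos`), AND THIS FILE's link reading `hlink`: `HybridNE7Under (datumOfRecord₁₃CoPH F N θ hP) (EndpointExistence …)` at every guarded admissible tuple —
this seat's composer `N19CoreEdgeFSCComposer.keyedGuarded₁₃CoPH_of_keyedFacesP_fsc_forallRates` (p595910) with `h19 := §2.mono` given `hβw` and `hunif`.  At `N = 2`, `G := θ.ZhUnity F 2 ∧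
θ.SlotsNondegenerate₁₃ F 2` the conclusion is K3⁷'s as leaf D states it — MODULO `hlink` (NODE O's world at the runs of record on the tuning window, 0∕1 inhabited), the other
slots and K1⁷'s window.  NOT a proof of K3⁷ or of any stub; N19 NOT discharged. -/
theorem hybridNE7Under_datumOfRecord₁₃CoPH_of_linkReadingAtTuningWindow
    (ks : (F : T4Family) → (θ : Stage13HParams F N) → θ.Provisos₁₃CoPH F N → (ℕ → ℝ) → List (ULoop F) → ℕ)
    (h20 : ∀ (F : T4Family) (θ : Stage13HParams F N) (hP : θ.Provisos₁₃CoPH F N), G θ → θ.Admissible F N → ∀ (g₀ : ℕ → ℝ) (os : List (ULoop F)),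
      RelWeightBound (cr F θ hP g₀ os).l₀ (cr F θ hP g₀ os).T (cr F θ hP g₀ os).A (cr F θ hP g₀ os).B (cr F θ hP g₀ os).Bad (cr F θ hP g₀ os).W)
    (h21 : ∀ (F : T4Family) (θ : Stage13HParams F N) (hP : θ.Provisos₁₃CoPH F N), G θ → θ.Admissible F N → ∀ (g₀ : ℕ → ℝ) (os : List (ULoop F)),
      ShellWeightBound (cr F θ hP g₀ os).l₀ (cr F θ hP g₀ os).T (cr F θ hP g₀ os).A (cr F θ hP g₀ os).B (cr F θ hP g₀ os).shA (cr F θ hP g₀ os).shB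
        (cr F θ hP g₀ os).Wsh)
    (hrates : ∀ (F : T4Family) (θ : Stage13HParams F N) (hP : θ.Provisos₁₃CoPH F N), G θ → θ.Admissible F N → ∀ (g₀ : ℕ → ℝ) (os : List (ULoop F)),
      RatesHolderAt (datumOfRecord₁₃CoPH F N θ hP) (rateCarriersOfRecord₁₃CoPH 𝔯 F θ hP g₀ os (ks F θ hP g₀ os)) β ∧
        ReadOutAt (datumOfRecord₁₃CoPH F N θ hP) (rateCarriersOfRecord₁₃CoPH 𝔯 F θ hP g₀ os (ks F θ hP g₀ os)).u3 ∧
        (0 ≤ (rateCarriersOfRecord₁₃CoPH 𝔯 F θ hP g₀ os (ks F θ hP g₀ os)).u3.ρ ∧ (rateCarriersOfRecord₁₃CoPH 𝔯 F θ hP g₀ os (ks F θ hP g₀ os)).u3.ρ < 1))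
    (hβw : ∀ (F : T4Family) (θ : Stage13HParams F N) (hP : θ.Provisos₁₃CoPH F N), G θ → θ.Admissible F N →
      ∃ γ₀ b b' : ℝ, 0 < γ₀ ∧ 0 < b ∧ DagBinding.BetaBoundsInInterval (datumOfRecord₁₃CoPH F N θ hP).C.toB12 γ₀ b b')
    (hunif : ∀ (F : T4Family) (θ : Stage13HParams F N) (hP : θ.Provisos₁₃CoPH F N), G θ → θ.Admissible F N →
      ∃ M ρ₁ : ℝ, 0 ≤ M ∧ ρ₁ < 1 ∧ ∀ (g₀ : ℕ → ℝ) (os : List (ULoop F)) (k : ℕ), 0 < (rateCarriersOfRecord₁₃CoPH 𝔯 F θ hP g₀ os k).u3.ρ ∧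
        (rateCarriersOfRecord₁₃CoPH 𝔯 F θ hP g₀ os k).u3.ρ ≤ ρ₁ ∧
        (rateCarriersOfRecord₁₃CoPH 𝔯 F θ hP g₀ os k).u3.cr * (rateCarriersOfRecord₁₃CoPH 𝔯 F θ hP g₀ os k).u3.C₉ * (rateCarriersOfRecord₁₃CoPH 𝔯 F θ hP g₀ os k).u3.ω ≤ M)
    (hx : ∀ (F : T4Family) (θ : Stage13HParams F N) (hP : θ.Provisos₁₃CoPH F N), G θ → θ.Admissible F N →
      B16.EndStatementBPrinted (datumOfRecord₁₃CoPH F N θ hP).C → DagBinding.EndpointExistence (datumOfRecord₁₃CoPH F N θ hP).C.toB12 →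
        ForSmallCouplings (datumOfRecord₁₃CoPH F N θ hP) fun g₀ => ∀ os : List (ULoop F),
          0 < (cr F θ hP g₀ os).l₀ ∧ 0 < (cr F θ hP g₀ os).vol ∧
          (∀ (K : ℕ) (t : ℝ), |t| ≤ (cr F θ hP g₀ os).l₀ →
            T4GenFunBounds.schemeZ ((datumOfRecord₁₃CoPH F N θ hP).scheme g₀) os ((cr F θ hP g₀ os).K₀ + K) t =
              ∑ τ ∈ (cr F θ hP g₀ os).T K, (cr F θ hP g₀ os).A K t τ) ∧
          (∀ (K : ℕ) (t : ℝ), |t| ≤ (cr F θ hP g₀ os).l₀ →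
            T4GenFunBounds.schemeZ ((datumOfRecord₁₃CoPH F N θ hP).scheme g₀) os ((cr F θ hP g₀ os).K₀ + K + 1) t =
              ∑ τ ∈ (cr F θ hP g₀ os).T K, (cr F θ hP g₀ os).B K t τ))
    (F : T4Family) (θ : Stage13HParams F N) (hP : θ.Provisos₁₃CoPH F N) (hG : G θ) (hθ : θ.Admissible F N) :
    HybridNE7Under (datumOfRecord₁₃CoPH F N θ hP) (DagBinding.EndpointExistence (datumOfRecord₁₃CoPH F N θ hP).C.toB12) :=
  keyedGuarded₁₃CoPH_of_keyedFacesP_fsc_forallRates cr (fun F θ hP g₀ os => rateCarriersOfRecord₁₃CoPH 𝔯 F θ hP g₀ os (ks F θ hP g₀ os)) G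
    (fun D R => RatesHolderAt D R β ∧ ReadOutAt D R.u3 ∧ (0 ≤ R.u3.ρ ∧ R.u3.ρ < 1)) h20 h21 hrates
    (fun F θ hP hG hθ _ _ => by
      obtain ⟨γ₀, b, b', hγ₀, hb0, hβ⟩ := hβw F θ hP hG hθ
      obtain ⟨M, ρ₁, hM, hρ₁, hu⟩ := hunif F θ hP hG hθ
      exact (forSmallCouplings_h19HolderD4_datumOfRecord₁₃CoPH_of_linkReadingAtTuningWindow cr 𝔯 G hβ1 hlink F θ hP hG hθ hγ₀ hb0 hβ hM hρ₁ hu).mono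
        fun g₀ h os => h os (ks F θ hP g₀ os))
    hx F θ hP hG hθ

end AtTuningWindow

end Summit.QuantumFields.YangMills.BalabanUVNodes.N19RateEdgeHolderD4AtTuningWindow

end
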